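import Summits.Ventures.GridStability.Models.NE39SP
import Summits.Ventures.GridStability.Lyapunov.StructurePreservingSwitchRoa
import HarnessLib

/-!
# GridStability/Bench/NE39SPSwitchDefs — N−1 switching on the 49-node STRUCTURE-PRESERVING New England
# instance: the post-switch model «branch `k` opened, injections kept» and the switching theorem
# specialised to it (line «G2.b-NE39SP-N1-SWITCH», file 0 of the instance series)

Cell `gridfusion` (LADDER-GRIDFUSION), seat gridfusion-lyap-1 (g9). INSTANCE OF RECORD BY NAME: model-2's
`Models/NE39SP.lean` (`NE39SP.params D`; data model-4 `bench/data/NE39/sp49/sp49.json` fddec35dcf838149 =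
[cite: Padiyar2013, App. D Tables D.1–D.4]: edge list `srcV`/`tgtV` (56 coupled pairs = 34 lines + 12
transformers + 10 machine reactances), column-LF couplings `wtLFQ`, half-angle tangents `tLFQ` of the
synchronous state `δ₀`, injections `P⁰ := f(δ₀)`, inertias `MQ`, generator set `genS`; the damping /
load-frequency vector `D > 0` is a PARAMETER). GENERIC THEOREM OF RECORD: this seat's
`Switch.switch_resync_of_check` (`Lyapunov/StructurePreservingSwitchRoa.lean`). NO NEW DATA LITERAL.

WHAT IS HERE: `wOpen k` (the post-switch weights: listed branch `k` opened, every other coupling of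
record kept), `paramsOpen k D` (the post-switch structure-preserving data: SAME `M`, `D`, `P⁰`, `gen` as
`NE39SP.params D`, couplings from `wOpen k`), its bookkeeping lemmas, and **`switch_resync_open`** — the
switching theorem for this instance modulo ONE hypothesis `C.check srcV tgtV wtLFQ (wOpen k) tLFQ 39` on a
rational certificate `C`, which the files `Bench/NE39SPLineSwitch*.lean` discharge branch by branch with
`decide`. THREE COLUMNS: CERTIFIED (there) = for MODEL M′ₖ = MV-3 New England SP with branch `k` open
and the injections of record: existence of the post-switch synchronous state (enclosed) and
re-synchronisation of EVERY solution from the pre-switch synchronous state, for every `D > 0`; MODELLED =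
model-2's tokens «MV-3 + lossless + MV-P + D(∀) + ω_s declared + V-frozen(LF) + |E|′(h12)» PLUS «branch
opened at t = 0 WITHOUT a fault, no reclosure, no protection action, tap ratios as in column LF;
branches whose opening islands a bus or machine are out of scope»; VALIDATED = nothing (no printed
time-domain comparison exists for this model). No sentence here says the New England system is stable
or N−1 secure. Two definitions (`wOpen`, `paramsOpen`); no named fact; standard axioms.
-/

noncomputable section

open Set Filter Topology Real Finset
open Summit.Ventures.GridStability.Models
open Summit.Ventures.GridStability.Models.StructurePreserving
open Summit.Ventures.GridStability.Models.NE39SP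
open Summit.Ventures.GridStability.Lyapunov.StructurePreserving
open Summit.Ventures.GridStability.Lyapunov.StructurePreserving.Switch

namespace Summit.Ventures.GridStability.Bench.NE39SP

/-- **Post-switch couplings: listed branch `k` OPENED** (its coupling set to `0`), every other
column-LF coupling of record kept (`NE39SP.wtLFQ`). MODELLED: switching without fault. [folklore] -/
def wOpen (k : Fin 56) (e : Fin 56) : ℚ := if e = k then 0 else NE39SP.wtLFQ e

/-- **The post-switch structure-preserving data** `M′ₖ`: model-2's `NE39SP.params D` with the couplings
replaced by those of `wOpen k` — SAME inertias, damping / load-frequency vector `D`, injections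
`P⁰ := f(δ₀)` of record and generator set. MODEL MV-3. [folklore] -/
def paramsOpen (k : Fin 56) (D : Fin 49 → ℝ) : Params 49 :=
  { NE39SP.params D with b := symmetrize (edgeWeight NE39SP.srcV NE39SP.tgtV fun e => (wOpen k e : ℝ)) }

/-- Unfolding: the post-switch couplings. [folklore] -/
theorem paramsOpen_b (k : Fin 56) (D : Fin 49 → ℝ) :
    (paramsOpen k D).b = symmetrize (edgeWeight NE39SP.srcV NE39SP.tgtV fun e => (wOpen k e : ℝ)) := rfl

/-- Unfolding: the damping / load-frequency vector is the parameter `D`. [folklore] -/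
theorem paramsOpen_D (k : Fin 56) (D : Fin 49 → ℝ) : (paramsOpen k D).D = D := rfl

/-- Unfolding: the generator set is model-2's `genS`. [folklore] -/
theorem paramsOpen_gen (k : Fin 56) (D : Fin 49 → ℝ) : (paramsOpen k D).gen = NE39SP.genS := rfl

/-- **The injections are KEPT**: `(paramsOpen k D).P0ᵢ = fᵢ(δ₀)` = the rational mirror `flowQ` of the
PRE-switch couplings at the pre-switch half-angle point (kit lemma `pe_halfAngle_eq_flowQ`). [folklore] -/
theorem paramsOpen_P0 (k : Fin 56) (D : Fin 49 → ℝ) (i : Fin 49) :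
    (paramsOpen k D).P0 i
      = flowQ NE39SP.srcV NE39SP.tgtV (fun e => (NE39SP.wtLFQ e : ℝ)) (fun j => (NE39SP.tLFQ j : ℝ)) i := by
  show (NE39SP.params D).pe NE39SP.δ₀ i = _
  rw [Params.pe, params_b]
  exact pe_halfAngle_eq_flowQ NE39SP.srcV NE39SP.tgtV NE39SP.wt NE39SP.t i

/-- **Well-formedness of the post-switch data** (printed sign pattern of `M` from model-2's
`NE39SP.wellFormed`, `D > 0` the hypothesis, symmetric couplings). [folklore] -/
theorem paramsOpen_wellFormed (k : Fin 56) {D : Fin 49 → ℝ} (hD : ∀ i, 0 < D i) :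
    (paramsOpen k D).WellFormed where
  M_pos := (NE39SP.wellFormed hD).M_pos
  M_eq_zero := (NE39SP.wellFormed hD).M_eq_zero
  D_pos := hD
  b_symm := fun i j => symmetrize_symm _ i j

/-- **THE SWITCHING THEOREM FOR THE NEW ENGLAND SP INSTANCE, modulo one rational check.** For a listed
branch `k` and a certificate `C` with `C.check srcV tgtV wtLFQ (wOpen k) tLFQ 39`: for EVERY damping /
load-frequency vector `D > 0`, the post-switch model `M′ₖ = paramsOpen k D` (branch `k` opened at
`t = 0` without fault, injections of record kept) HAS a synchronous angle vector `θ` — all 49 lossless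
power-flow equations `fᵢ(θ) = P⁰ᵢ` exactly, pinned at G1's internal node to the certificate's half-angle
point and within `R` of it at every node, every coupled branch inside `2·arctan τγ < π/2` — and EVERY
solution `δ` of `M′ₖ` AS PRINTED starting at the PRE-switch synchronous state (`δ(0) = δ₀`, zero
generator frequency deviations) keeps Vu–Turitsyn's polytope `|(δᵢ − δⱼ) + (θᵢ − θⱼ)| < π` on coupled
pairs and `V(θ; δ(t), δ̇(t)) ≤ c` for all `t ≥ 0`, and re-synchronises: `δ(t) → θ + κ·1`,
`κ = Σ Dᵢ(δ₀ᵢ − θᵢ)/Σ Dᵢ`, `δ̇ᵢ(t) → 0` at every machine. MODEL MV-3; no sentence here says the New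
England system is stable or N−1 secure. [cite: VuTuritsyn2016, §IV, §VI; Padiyar2013, App. D] -/
theorem switch_resync_open {k : Fin 56} {C : Cert 49 56}
    (hchk : C.check NE39SP.srcV NE39SP.tgtV NE39SP.wtLFQ (wOpen k) NE39SP.tLFQ 39)
    (D : Fin 49 → ℝ) (hD : ∀ i, 0 < D i) :
    ∃ θ : Fin 49 → ℝ,
      θ 39 = halfAngle (fun i => (C.t1 i : ℝ)) 39 ∧
      (∀ i, |θ i - halfAngle (fun i => (C.t1 i : ℝ)) i| < (C.R : ℝ)) ∧
      (∀ i, (paramsOpen k D).pe θ i = (paramsOpen k D).P0 i) ∧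
      (∀ i j, i ≠ j → (paramsOpen k D).b i j ≠ 0 → |θ i - θ j| < 2 * Real.arctan (C.τγ : ℝ)) ∧
      ∀ δ : ℝ → Fin 49 → ℝ, (paramsOpen k D).IsSolution δ → δ 0 = NE39SP.δ₀ →
        (∀ i ∈ NE39SP.genS, deriv (fun u => δ u i) 0 = 0) →
        (∀ t, 0 ≤ t →
            (∀ i j, (paramsOpen k D).b i j ≠ 0 → |(δ t i - δ t j) + (θ i - θ j)| < π) ∧
              (paramsOpen k D).energy θ (δ t) (fun i => deriv (fun u => δ u i) t) ≤ (C.c : ℝ)) ∧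
          Tendsto δ atTop (𝓝 fun i => θ i + (∑ j, D j * (NE39SP.δ₀ j - θ j)) / ∑ j, D j) ∧
          ∀ i ∈ NE39SP.genS, Tendsto (fun t => deriv (fun u => δ u i) t) atTop (𝓝 0) :=
  switch_resync_of_check hchk (by decide) (paramsOpen_wellFormed k hD) (paramsOpen_b k D)
    (paramsOpen_P0 k D)

end Summit.Ventures.GridStability.Bench.NE39SP

end
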